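import Summits.Ventures.LatticeQCDFlow.Scaling.HubChainTransitionLaw

/-!
HONEST FRAMING: exact (Metropolis-corrected) sampling algorithms for lattice gauge theory; figures
of merit are autocorrelation/cost numbers at stated couplings and volumes; no continuum-physics
claim.

# HubChainDeepestTagDomination — A PER-STEP CASE OF CONJECTURE M′: WHEN THE TAGGED PARTICLE IS THE DEEPEST (LIGHTEST), RAISING ITS DEPTH LOWERS EVERY `n`-STEP TRANSITION PROBABILITY
# BETWEEN THE OTHER PARTICLES — INCLUDING THE DIAGONAL: `P_Yⁿ(i,j) ≤ P_Xⁿ(i,j)` FOR ALL `n` AND ALL `i, j` OTHER THAN THE TAG (lean-2 GEN-39, ours)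

Venture-side (OURS).  Cell `lqcd-flow` (pub-lqcd), unit `pub-lqcd-lean-2-g39`, 2026-08-30.  Chapter Y, file 6.  Setting of files 1–2 for TWO depth profiles `ρ^X ≤ ρ^Y` on the ranks that agree
below the top rank `m−1` and differ there (`ρ^X_{m−1} ≤ ρ^Y_{m−1}`; both non-decreasing, so the tagged particle ★ is the deepest in both chains).  By the Smith–Tierney form of file 2,
for `i, j < m−1` both chains have `Pⁿ(i,j) = ρ_j·T_n(max(i,j)) + β_iⁿδ_{ij}` with the SAME `β_i` and, splitting the top rank off `T_n`,
`T_n(j) = [common part] + (1 − β_jⁿ)/R_{m−1} − (c/R_{m−1})·S_n(β_{m−1})`, `S_n(b) = Σ_{t<n}bᵗ`, where only `β_{m−1} = 1 − c(1 + R_{m−1}/ρ_★)` sees the tag and increases with its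
depth.  Since `S_n` is non-decreasing on `[−1/2, ∞)` (two-step induction; `β ≥ 1 − cm ≥ −1/2` when `cm ≤ 3/2`, e.g. `c = 1/K`, `m = K+1`, `K ≥ 2`), `T^Y_n ≤ T^X_n`:

* `geomPartial_nonneg`, `geomPartial_half_le` (`S_k(y)(1/2 − y) ≤ 1` on `[−1/2,1/2]`), **`geomPartial_mono`** (`−1/2 ≤ x ≤ y ⇒ S_n(x) ≤ S_n(y)`);
* `deepTag_T_split` (the top-rank split of `T_n`), **`deepTag_T_le`** (`T^Y_n(j) ≤ T^X_n(j)` for `j < m−1`);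
* **`deepTag_pow_le`**: `P_Yⁿ(i,j) ≤ P_Xⁿ(i,j)` for all `n` and all `i, j < m−1` — per-step domination from every start other than ★, at every target other than ★, diagonal included.

Contrast file 5 (`HubChainPerStepCounterexample`): with ★ the SHALLOWEST the diagonal fails at `n = 2`.  Reading (no numerics implied): in the adjacent-pair language of chapter W, if the
differing particle is lighter than every common particle and the hub particle, the `j`-attempt hub occupations are dominated attempt by attempt (the input the clock-conditioned route of
files C1–C3 asks for, in this case).  Literature grade (cell rule): OWN, elementary; nothing cited; no new bib keys.
-/

open Finset

namespace Summit.Ventures.LatticeQCDFlow.Scaling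

/-! ### §1 The partial geometric sums `S_n(b) = Σ_{t<n} bᵗ` are non-decreasing on `[−1/2, ∞)` -/
section GeomPartial

/-- Two-step recursion: `S_{n+2}(b) = 1 + b + b²S_n(b)`. [ours] -/
theorem geomPartial_succ_succ (b : ℝ) (n : ℕ) : ∑ t ∈ range (n + 2), b ^ t = 1 + b + b ^ 2 * ∑ t ∈ range n, b ^ t := by
  induction n with
  | zero => simp [sum_range_succ]
  | succ n ih =>
      rw [sum_range_succ, ih, sum_range_succ, show n + 2 = n + 1 + 1 from rfl]
      ring

/-- `S_n(y) ≥ 0` for `y ≥ −1`. [ours] -/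
theorem geomPartial_nonneg {y : ℝ} (hy : -1 ≤ y) : ∀ n, 0 ≤ ∑ t ∈ range n, y ^ t := by
  suffices h : ∀ n, (0 ≤ ∑ t ∈ range n, y ^ t) ∧ 0 ≤ ∑ t ∈ range (n + 1), y ^ t from fun n => (h n).1
  intro n
  induction n with
  | zero => simp
  | succ n ih => exact ⟨ih.2, by rw [show n + 1 + 1 = n + 2 from rfl, geomPartial_succ_succ]; nlinarith [ih.1, sq_nonneg y]⟩

/-- `S_n(y)·(1/2 − y) ≤ 1` for `−1/2 ≤ y` (trivial for `y ≥ 1/2`). [ours] -/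
theorem geomPartial_half_le {y : ℝ} (hy1 : -1 / 2 ≤ y) : ∀ n, (∑ t ∈ range n, y ^ t) * (1 / 2 - y) ≤ 1 := by
  suffices h : ∀ n, ((∑ t ∈ range n, y ^ t) * (1 / 2 - y) ≤ 1) ∧ (∑ t ∈ range (n + 1), y ^ t) * (1 / 2 - y) ≤ 1 from fun n => (h n).1
  intro n
  induction n with
  | zero => refine ⟨by simp, by simp; linarith⟩
  | succ n ih =>
      refine ⟨ih.2, ?_⟩
      rw [show n + 1 + 1 = n + 2 from rfl, geomPartial_succ_succ]
      have h0 := geomPartial_nonneg (by linarith : (-1:ℝ) ≤ y) n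
      nlinarith [ih.1, sq_nonneg y, mul_nonneg (sq_nonneg y) h0]

/-- **`S_n` is non-decreasing on `[−1/2, ∞)`:** `−1/2 ≤ x ≤ y ⇒ Σ_{t<n}xᵗ ≤ Σ_{t<n}yᵗ`. [ours] -/
theorem geomPartial_mono {x y : ℝ} (hx : -1 / 2 ≤ x) (hxy : x ≤ y) : ∀ n, ∑ t ∈ range n, x ^ t ≤ ∑ t ∈ range n, y ^ t := by
  -- the key step: `1 + (x+y)S_n(y) ≥ 0`
  have key : ∀ n, 0 ≤ 1 + (x + y) * ∑ t ∈ range n, y ^ t := by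
    intro n
    have hSy := geomPartial_nonneg (by linarith : (-1:ℝ) ≤ y) n
    rcases le_or_gt 0 (x + y) with hs | hs
    · nlinarith
    · -- `x + y < 0`: then `−(x+y) ≤ 1/2 − y`
      have h := geomPartial_half_le (by linarith : -1/2 ≤ y) n
      nlinarith
  suffices h : ∀ n, (∑ t ∈ range n, x ^ t ≤ ∑ t ∈ range n, y ^ t) ∧ (∑ t ∈ range (n + 1), x ^ t ≤ ∑ t ∈ range (n + 1), y ^ t) from fun n => (h n).1
  intro n
  induction n with
  | zero => simp
  | succ n ih =>
      refine ⟨ih.2, ?_⟩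
      rw [show n + 1 + 1 = n + 2 from rfl, geomPartial_succ_succ, geomPartial_succ_succ]
      -- `S_{n+2}(y) − S_{n+2}(x) = (y−x)(1 + (x+y)S_n(y)) + x²(S_n(y) − S_n(x))`
      have e : (1 + y + y ^ 2 * ∑ t ∈ range n, y ^ t) - (1 + x + x ^ 2 * ∑ t ∈ range n, x ^ t)
          = (y - x) * (1 + (x + y) * ∑ t ∈ range n, y ^ t) + x ^ 2 * (∑ t ∈ range n, y ^ t - ∑ t ∈ range n, x ^ t) := by ring
      nlinarith [key n, ih.1, sq_nonneg x, mul_nonneg (sq_nonneg x) (sub_nonneg.mpr ih.1), mul_nonneg (sub_nonneg.mpr hxy) (key n)]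

end GeomPartial

/-! ### §2 The top-rank split of `T_n` and the comparison -/
section DeepTag
variable {m : ℕ} {ρX ρY RX RY βX βY : ℕ → ℝ} {c : ℝ} {PX PY fX fY : ℕ → ℕ → ℝ} {PnX PnY : ℕ → ℕ → ℕ → ℝ} {TX TY : ℕ → ℕ → ℝ}

/-- **The top-rank split:** for `j + 1 ≤ m − 1` (so `m ≥ 2`),
`T_n(j) = Σ_{j<k<m−1}(1/R_k − 1/R_{k+1})(β_kⁿ − β_jⁿ) + (1 − β_jⁿ)/R_{m−1} − (c/R_{m−1})·S_n(β_{m−1})`. [ours] -/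
theorem deepTag_T_split {ρ R β : ℕ → ℝ} {T : ℕ → ℕ → ℝ} (hρ : ∀ i, 0 < ρ i) (hR : ∀ k, R k = ∑ i ∈ range k, ρ i)
    (hβ : ∀ k, β k = 1 - c * (((m - k : ℕ) : ℝ) + R k / ρ k))
    (hT : ∀ n j, T n j = (1 - β j ^ n) / R m + ∑ k ∈ Ico (j + 1) m, (1 / R k - 1 / R (k + 1)) * (β k ^ n - β j ^ n))
    (n : ℕ) {j : ℕ} (hj : j + 1 ≤ m - 1) (hm : 2 ≤ m) :
    T n j = (∑ k ∈ Ico (j + 1) (m - 1), (1 / R k - 1 / R (k + 1)) * (β k ^ n - β j ^ n)) + (1 - β j ^ n) / R (m - 1)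
      - c / R (m - 1) * ∑ t ∈ range n, β (m - 1) ^ t := by
  have hm1 : m = (m - 1) + 1 := by omega
  have hRm : R m = R (m - 1) + ρ (m - 1) := by rw [hR m, hR (m - 1)]; conv_lhs => rw [hm1]; rw [sum_range_succ]
  have hR1 : 0 < R (m - 1) := by rw [hR (m - 1)]; exact sum_pos (fun i _ => hρ i) ⟨j, mem_range.mpr (by omega)⟩
  have hρs := hρ (m - 1)
  have hRmpos : 0 < R m := by rw [hRm]; linarith
  -- `1 − β_{m−1} = c(1 + R_{m−1}/ρ_{m−1})`
  have hb : 1 - β (m - 1) = c * (R (m - 1) + ρ (m - 1)) / ρ (m - 1) := by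
    rw [hβ (m - 1), show m - (m - 1) = 1 by omega]; push_cast; field_simp; ring
  -- `(1 − bⁿ) = (1 − b)·S_n(b)`
  have hgeom : 1 - β (m - 1) ^ n = (1 - β (m - 1)) * ∑ t ∈ range n, β (m - 1) ^ t := by
    have h := renewal_weights_sum' (β (m - 1)) n
    rw [← sum_mul] at h
    linarith
  rw [hT n j, ← Finset.sum_Ico_consecutive _ (by omega : j + 1 ≤ m - 1) (by omega : m - 1 ≤ m),
    Finset.sum_eq_sum_Ico_succ_bot (by omega : m - 1 < m), show m - 1 + 1 = m by omega, Finset.Ico_self, sum_empty, add_zero, hRm]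
  -- pure algebra in `R' = R_{m−1}`, `ρ★`, `b = β_{m−1}`, `b0 = β_j`
  have e1 : (1 / R (m - 1) - 1 / (R (m - 1) + ρ (m - 1))) * (β (m - 1) ^ n - β j ^ n) + (1 - β j ^ n) / (R (m - 1) + ρ (m - 1))
      = (1 - β j ^ n) / R (m - 1) - (1 / R (m - 1) - 1 / (R (m - 1) + ρ (m - 1))) * (1 - β (m - 1) ^ n) := by
    field_simp; ring
  have e2 : (1 / R (m - 1) - 1 / (R (m - 1) + ρ (m - 1))) * (1 - β (m - 1) ^ n) = c / R (m - 1) * ∑ t ∈ range n, β (m - 1) ^ t := by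
    rw [hgeom, hb]; field_simp; ring
  linarith [e1, e2]
where
  /-- `1 − bⁿ = (1 − b)·Σ_{t<n}bᵗ` (the geometric identity, restated locally). -/
  renewal_weights_sum' (b : ℝ) (n : ℕ) : ∑ t ∈ range n, b ^ t * (1 - b) = 1 - b ^ n := by
    induction n with
    | zero => simp
    | succ n ih => rw [sum_range_succ, ih, pow_succ]; ring

/-- **`T^Y_n(j) ≤ T^X_n(j)` for `j < m−1`** when the two depth profiles agree below the top rank, `ρ^X_{m−1} ≤ ρ^Y_{m−1}`, `0 ≤ c` and `c·m ≤ 3/2` (so every `β ≥ −1/2`). [ours] -/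
theorem deepTag_T_le (hρX : ∀ i, 0 < ρX i) (hmonoX : Monotone ρX) (hρY : ∀ i, 0 < ρY i)
    (hagree : ∀ i, i ≠ m - 1 → ρX i = ρY i) (htop : ρX (m - 1) ≤ ρY (m - 1))
    (hRX : ∀ k, RX k = ∑ i ∈ range k, ρX i) (hRY : ∀ k, RY k = ∑ i ∈ range k, ρY i)
    (hβX : ∀ k, βX k = 1 - c * (((m - k : ℕ) : ℝ) + RX k / ρX k)) (hβY : ∀ k, βY k = 1 - c * (((m - k : ℕ) : ℝ) + RY k / ρY k))
    (hTX : ∀ n j, TX n j = (1 - βX j ^ n) / RX m + ∑ k ∈ Ico (j + 1) m, (1 / RX k - 1 / RX (k + 1)) * (βX k ^ n - βX j ^ n))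
    (hTY : ∀ n j, TY n j = (1 - βY j ^ n) / RY m + ∑ k ∈ Ico (j + 1) m, (1 / RY k - 1 / RY (k + 1)) * (βY k ^ n - βY j ^ n))
    (hc : 0 ≤ c) (hcm : c * m ≤ 3 / 2) (n : ℕ) {j : ℕ} (hj : j + 1 ≤ m - 1) (hm : 2 ≤ m) : TY n j ≤ TX n j := by
  -- below the top rank everything agrees
  have hRagree : ∀ k, k ≤ m - 1 → RX k = RY k := by
    intro k hk; rw [hRX, hRY]; exact sum_congr rfl fun i hi => hagree i (by have := mem_range.mp hi; omega)
  have hβagree : ∀ k, k < m - 1 → βX k = βY k := by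
    intro k hk; rw [hβX, hβY, hRagree k hk.le, hagree k (by omega)]
  rw [deepTag_T_split hρX hRX hβX hTX n hj hm, deepTag_T_split hρY hRY hβY hTY n hj hm]
  have hcommon : ∑ k ∈ Ico (j + 1) (m - 1), (1 / RY k - 1 / RY (k + 1)) * (βY k ^ n - βY j ^ n)
      = ∑ k ∈ Ico (j + 1) (m - 1), (1 / RX k - 1 / RX (k + 1)) * (βX k ^ n - βX j ^ n) := by
    refine sum_congr rfl fun k hk => ?_
    have hk' : j + 1 ≤ k ∧ k < m - 1 := by simpa using mem_Ico.mp hk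
    rw [hRagree k (by omega), hRagree (k + 1) (by omega), hβagree k hk'.2, hβagree j (by omega)]
  rw [hcommon, hβagree j (by omega), hRagree (m - 1) le_rfl]
  -- it remains: `(c/R')S_n(β^X_{m−1}) ≤ (c/R')S_n(β^Y_{m−1})`
  have hR1 : 0 < RY (m - 1) := by rw [hRY (m - 1)]; exact sum_pos (fun i _ => hρY i) ⟨j, mem_range.mpr (by omega)⟩
  have hbXY : βX (m - 1) ≤ βY (m - 1) := by
    rw [hβX, hβY, hRagree (m - 1) le_rfl]
    have h1 : RY (m - 1) / ρY (m - 1) ≤ RY (m - 1) / ρX (m - 1) := div_le_div_of_nonneg_left hR1.le (hρX _) htop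
    nlinarith
  have hbX : -1 / 2 ≤ βX (m - 1) := by
    have := hubChain_beta_ge hρX hmonoX hRX hβX hc (by omega : m - 1 < m)
    linarith
  have hS := geomPartial_mono hbX hbXY n
  have hcR : 0 ≤ c / RY (m - 1) := div_nonneg hc hR1.le
  nlinarith [mul_le_mul_of_nonneg_left hS hcR]

/-- **PER-STEP DOMINATION WITH THE DEEPEST TAG:** under the hypotheses of `deepTag_T_le` and with the kernels, eigen-data and powers of files 1–2 for both profiles:
`P_Yⁿ(i,j) ≤ P_Xⁿ(i,j)` for every `n` and all `i, j < m − 1` (every start and target other than the tagged top rank, the diagonal included). [ours] -/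
theorem deepTag_pow_le (hρX : ∀ i, 0 < ρX i) (hmonoX : Monotone ρX) (hρY : ∀ i, 0 < ρY i) (hmonoY : Monotone ρY)
    (hagree : ∀ i, i ≠ m - 1 → ρX i = ρY i) (htop : ρX (m - 1) ≤ ρY (m - 1))
    (hRX : ∀ k, RX k = ∑ i ∈ range k, ρX i) (hRY : ∀ k, RY k = ∑ i ∈ range k, ρY i)
    (hPXoff : ∀ i j, i ≠ j → PX i j = c * min 1 (ρX j / ρX i)) (hPXdiag : ∀ i, PX i i = 1 - ∑ j ∈ (range m).erase i, PX i j)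
    (hPYoff : ∀ i j, i ≠ j → PY i j = c * min 1 (ρY j / ρY i)) (hPYdiag : ∀ i, PY i i = 1 - ∑ j ∈ (range m).erase i, PY i j)
    (hfX : ∀ k i, fX k i = if i < k then ρX k else if i = k then -RX k else 0) (hfY : ∀ k i, fY k i = if i < k then ρY k else if i = k then -RY k else 0)
    (hβX : ∀ k, βX k = 1 - c * (((m - k : ℕ) : ℝ) + RX k / ρX k)) (hβY : ∀ k, βY k = 1 - c * (((m - k : ℕ) : ℝ) + RY k / ρY k))
    (hPX0 : ∀ i j, PnX 0 i j = if i = j then 1 else 0) (hPXs : ∀ n i j, PnX (n + 1) i j = ∑ l ∈ range m, PnX n i l * PX l j)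
    (hPY0 : ∀ i j, PnY 0 i j = if i = j then 1 else 0) (hPYs : ∀ n i j, PnY (n + 1) i j = ∑ l ∈ range m, PnY n i l * PY l j)
    (hTX : ∀ n j, TX n j = (1 - βX j ^ n) / RX m + ∑ k ∈ Ico (j + 1) m, (1 / RX k - 1 / RX (k + 1)) * (βX k ^ n - βX j ^ n))
    (hTY : ∀ n j, TY n j = (1 - βY j ^ n) / RY m + ∑ k ∈ Ico (j + 1) m, (1 / RY k - 1 / RY (k + 1)) * (βY k ^ n - βY j ^ n))
    (hc : 0 ≤ c) (hcm : c * m ≤ 3 / 2) (n : ℕ) {i j : ℕ} (hi : i + 1 ≤ m - 1) (hj : j + 1 ≤ m - 1) (hm : 2 ≤ m) :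
    PnY n i j ≤ PnX n i j := by
  have him : i < m := by omega
  have hjm : j < m := by omega
  have hρj : ρX j = ρY j := hagree j (by omega)
  by_cases hij : i = j
  · subst hij
    rw [hubChain_pow_diag hρX hmonoX hRX hPXoff hPXdiag hfX hβX hPX0 hPXs hTX n him, hubChain_pow_diag hρY hmonoY hRY hPYoff hPYdiag hfY hβY hPY0 hPYs hTY n him]
    have hRi : RX i = RY i := by
      rw [hRX, hRY]; exact sum_congr rfl fun l hl => hagree l (by have h' := mem_range.mp hl; omega)
    have hβi : βX i = βY i := by rw [hβX, hβY, hagree i (by omega), hRi]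
    rw [hβi, ← hρj]
    exact add_le_add (mul_le_mul_of_nonneg_left (deepTag_T_le hρX hmonoX hρY hagree htop hRX hRY hβX hβY hTX hTY hc hcm n hi hm) (hρX i).le) le_rfl
  · rw [hubChain_pow_offdiag hρX hmonoX hRX hPXoff hPXdiag hfX hβX hPX0 hPXs hTX n him hjm hij,
      hubChain_pow_offdiag hρY hmonoY hRY hPYoff hPYdiag hfY hβY hPY0 hPYs hTY n him hjm hij, ← hρj]
    have hmax : max i j + 1 ≤ m - 1 := by
      rcases le_total i j with h | h
      · rw [max_eq_right h]; exact hj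
      · rw [max_eq_left h]; exact hi
    exact mul_le_mul_of_nonneg_left (deepTag_T_le hρX hmonoX hρY hagree htop hRX hRY hβX hβY hTX hTY hc hcm n hmax hm) (hρX j).le

end DeepTag

end Summit.Ventures.LatticeQCDFlow.Scaling
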